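import Summits.BirchSwinnertonDyer.BirchSwinnertonDyer.Theorems.UniversalToricDescentThinCombFibredSupply
import Literature.NumberTheory.EllipticCurves.ToricTwoVariablePAdicLFunctionUpTo
import Literature.NumberTheory.EllipticCurves.PAdicLFunctionInterpolationProofs
import Summits.BirchSwinnertonDyer.Rank1Residual.X11b.HalvesReceptacle
import Summits.BirchSwinnertonDyer.Rank1Residual.X11b.UnrIntegersUnitPowers
import Mathlib.Analysis.Normed.Group.FunctionSeries
import HarnessLib

/-!
# Values of `R₀⟦T₁⟧⟦T₂⟧`-series on closed polydiscs: the integral bound, continuity in the outer variable, `p`-power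
# accumulation of one-units, and the DECAY LEMMA «geometrically decaying values along an accumulating fibre are zero»
# (helper on the rational wall `RationalSplitIMCInclusionAtThree`, stmt-BirchSwinnertonDyer-24207, line `ratwall_thin_comb` v10;
# cell `pub/bsd-wall`, LEAD `cruxlead-24207` g37; `--supports stmt-BirchSwinnertonDyer-24207`; nothing is closed; BSD is not proved)

WHY THIS FILE. The SIZE RIGIDITY of ♯♯-frames (`…ThinComb.SizeRigidity`: a non-zero frame `L₂` with constants `(C, X, Y)` has
`‖X·κ̂‖ = ‖Y‖`) compares `L₂` with its reflection `φ_{A_τ}L₂` (a frame with constants `(C, Y/κ̂, X·κ̂)`, `…ThinComb.FrameReflection`):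
at the grid point `(i, j)` of the supply (`…ThinComb.GridSupply`) the two values differ by the factor `λ₀^{m(j−i)}`, `λ₀ = X·κ̂/Y`, and
both have norm `≤ 1`. If `‖λ₀‖ ≠ 1`, one of the two series has values decaying GEOMETRICALLY in `i` along every fibre `j`; since the
fibre points `c·u^{i+1} − 1` ACCUMULATE at each of themselves (`u^{pⁿ} → 1` for a one-unit `u`), continuity of the value in the outer
variable forces all these values to vanish, and the fibred identity principle kills the series. This file supplies the four
elementary analytic inputs, all in the tree's currency `UnrSeries.HasValueAt₂` (a `HasSum` in `ℂ_p`):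

* §1 `norm_le_one_of_hasValueAt₂` — the value of an `R₀`-series at a point of the closed unit polydisc has norm `≤ 1` (ultrametric
  bound of a convergent sum; `R₀ ⊆ 𝒪_{ℂ_p}`, tree `X11b.Halves.norm_coe_unrIntegers_le_one`).
* §2 `norm_pow_prime_sub_one_le`, `norm_pow_prime_pow_sub_one_le`, `tendsto_pow_prime_pow_nhds_one` — for a one-unit `w` of level
  `|p|` (`‖w − 1‖ < ‖p‖`): `‖w^p − 1‖ ≤ ‖p‖·‖w − 1‖` (binomial theorem, `p ∣ C(p, k)` for `0 < k < p`), hence `‖w^{pⁿ} − 1‖ ≤ ‖p‖ⁿ‖w − 1‖`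
  and `w^{pⁿ} → 1`.
* §3 `hasValueAt₂_of_tendsto` — CONTINUITY IN THE OUTER VARIABLE on a closed disc `‖x‖ ≤ ‖ϖ‖ < 1` (inner value `y` fixed, `‖y‖ ≤ ‖ϖ‖`):
  if `xₙ → x₀` in the disc and the values `L(xₙ, y)` tend to `w₀`, then `L(x₀, y) = w₀` (uniform convergence on the disc:
  `continuousOn_tsum` with the summable majorant `‖ϖ‖^{k₁+k₂}`).
* §4 **`eq_zero_of_hasValueAt₂_of_norm_le_geometric`** — THE DECAY LEMMA: if `L` has values `wᵢ` at the fibre points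
  `(c·u^{i+1} − 1, y)` (`c, u` one-units of level `|p|`, `‖y‖ ≤ ‖p‖`) with `‖wᵢ‖ ≤ C·θ^{i+1}` for some `θ < 1`, then every `wᵢ = 0`
  (apply §3 along `i + pⁿ`: the points tend to the `i`-th point by §2, the values to `0`).

HONEST SCOPE: elementary non-archimedean analysis; nothing here is evidence that a toric frame exists at the additive split `3`;
24207 / 20395 / 20186 / 32493 OPEN; BSD is proved for no curve.

References: [cite: Gouvea1993PadicNumbers, §5.6 Cor. 5.6.3–5.6.4 (values of bounded series on closed discs)] [cite: Washington1997, §5.1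
(one-units, binomial series)] [cite: deShalit1987, II.4.17 (54) (values of two-variable series at characters)]
-/

set_option linter.dupNamespace false
set_option autoImplicit false

noncomputable section

open Filter Topology
open Literature.NumberTheory.EllipticCurves Literature.NumberTheory.GaloisRepresentations
open Summit.BirchSwinnertonDyer.BirchSwinnertonDyer.Theorems
open Summit.BirchSwinnertonDyer.Rank1Residual.X11b.Halves (norm_coe_unrIntegers_le_one)
open Summit.BirchSwinnertonDyer.Rank1Residual.X11b.UnrUnits (norm_natCast_le_one)

namespace Summit.BirchSwinnertonDyer.BirchSwinnertonDyer.Theorems.UniversalToricDescentThinComb.ValueLimits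

variable {p : ℕ} [Fact p.Prime]

/-! ### §1. The integral bound -/

/-- **The value of an `R₀`-series at a point of the closed unit polydisc is integral**: `‖L(x, y)‖ ≤ 1` for `‖x‖, ‖y‖ ≤ 1`
(every term `[T₁^iT₂^j]L · x^i y^j` has norm `≤ 1`; ultrametric bound of the sum). [cite: Gouvea1993PadicNumbers, §5.6 Cor. 5.6.3] -/
theorem norm_le_one_of_hasValueAt₂ {L : PowerSeries (UnrSeries p)} {x y v : ℂ_[p]}
    (h : UnrSeries.HasValueAt₂ L x y v) (hx : ‖x‖ ≤ 1) (hy : ‖y‖ ≤ 1) : ‖v‖ ≤ 1 := by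
  rw [← HasSum.tsum_eq h]
  refine IsUltrametricDist.norm_tsum_le_of_forall_le_of_nonneg zero_le_one fun k ↦ ?_
  rw [norm_mul, norm_mul, norm_pow, norm_pow]
  calc ‖((PowerSeries.coeff k.2 (PowerSeries.coeff k.1 L) : unrIntegers p) : ℂ_[p])‖ * ‖x‖ ^ k.1 * ‖y‖ ^ k.2
      ≤ 1 * 1 ^ k.1 * 1 ^ k.2 := by
        gcongr
        exact norm_coe_unrIntegers_le_one (p := p) _
    _ = 1 := by simp

/-! ### §2. One-units of level `|p|`: `p`-powers accumulate at `1` -/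

/-- **`‖w^p − 1‖ ≤ ‖p‖·‖w − 1‖` for a one-unit `w` of level `|p|`** (`‖w − 1‖ < ‖p‖`): binomial theorem, `p ∣ C(p, k)` for
`0 < k < p`, and `‖(w−1)^p‖ ≤ ‖w−1‖² ≤ ‖p‖·‖w−1‖`. [cite: Washington1997, §5.1] -/
theorem norm_pow_prime_sub_one_le {w : ℂ_[p]} (hw : ‖w - 1‖ < ‖(p : ℂ_[p])‖) :
    ‖w ^ p - 1‖ ≤ ‖(p : ℂ_[p])‖ * ‖w - 1‖ := by
  have hp : p.Prime := Fact.out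
  have hp1 : ‖(p : ℂ_[p])‖ < 1 := norm_prime_padicComplex_lt_one
  set ε : ℂ_[p] := w - 1 with hε
  have hε1 : ‖ε‖ ≤ 1 := (hw.trans hp1).le
  have hw' : w = ε + 1 := by rw [hε]; ring
  -- binomial expansion: `w^p − 1 = ∑_{m<p} ε^{m+1}·C(p, m+1)`
  have hexp : w ^ p - 1 = ∑ m ∈ Finset.range p, ε ^ (m + 1) * ((p.choose (m + 1) : ℕ) : ℂ_[p]) := by
    have h1 : (ε + 1) ^ p = ∑ m ∈ Finset.range (p + 1), ε ^ m * ((p.choose m : ℕ) : ℂ_[p]) := by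
      rw [add_pow]; simp only [one_pow, mul_one]
    rw [hw', h1, Finset.sum_range_succ']
    simp
  rw [hexp]
  refine IsUltrametricDist.norm_sum_le_of_forall_le_of_nonneg (by positivity) fun m hm ↦ ?_
  rw [Finset.mem_range] at hm
  rw [norm_mul, norm_pow]
  rcases Nat.lt_or_ge (m + 1) p with hlt | hge
  · -- `p ∣ C(p, m+1)`
    obtain ⟨t, ht⟩ := hp.dvd_choose_self (Nat.succ_ne_zero m) hlt
    have hchoose : ‖((p.choose (m + 1) : ℕ) : ℂ_[p])‖ ≤ ‖(p : ℂ_[p])‖ := by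
      rw [ht, Nat.cast_mul, norm_mul]
      exact mul_le_of_le_one_right (norm_nonneg _) (norm_natCast_le_one t)
    calc ‖ε‖ ^ (m + 1) * ‖((p.choose (m + 1) : ℕ) : ℂ_[p])‖ ≤ ‖ε‖ * ‖(p : ℂ_[p])‖ := by
          gcongr
          exact pow_le_of_le_one (norm_nonneg _) hε1 (Nat.succ_ne_zero m)
      _ = ‖(p : ℂ_[p])‖ * ‖ε‖ := mul_comm _ _
  · -- `m + 1 = p`: the term `ε^p`
    have hmp : m + 1 = p := by omega
    rw [hmp, Nat.choose_self, Nat.cast_one, norm_one, mul_one]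
    calc ‖ε‖ ^ p ≤ ‖ε‖ ^ 2 := pow_le_pow_of_le_one (norm_nonneg _) hε1 hp.two_le
      _ = ‖ε‖ * ‖ε‖ := sq _
      _ ≤ ‖(p : ℂ_[p])‖ * ‖ε‖ := by gcongr

/-- **`‖w^{pⁿ} − 1‖ ≤ ‖p‖ⁿ·‖w − 1‖`** for a one-unit `w` of level `|p|` (induction on `n`). [cite: Washington1997, §5.1] -/
theorem norm_pow_prime_pow_sub_one_le {w : ℂ_[p]} (hw : ‖w - 1‖ < ‖(p : ℂ_[p])‖) (n : ℕ) :
    ‖w ^ (p ^ n) - 1‖ ≤ ‖(p : ℂ_[p])‖ ^ n * ‖w - 1‖ := by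
  induction n with
  | zero => simp
  | succ n ih =>
    have hp1 : ‖(p : ℂ_[p])‖ < 1 := norm_prime_padicComplex_lt_one
    have hlt : ‖w ^ (p ^ n) - 1‖ < ‖(p : ℂ_[p])‖ := by
      refine lt_of_le_of_lt ih (lt_of_le_of_lt ?_ hw)
      exact mul_le_of_le_one_left (norm_nonneg _) (pow_le_one₀ (norm_nonneg _) hp1.le)
    rw [pow_succ, pow_mul]
    calc ‖(w ^ p ^ n) ^ p - 1‖ ≤ ‖(p : ℂ_[p])‖ * ‖w ^ p ^ n - 1‖ := norm_pow_prime_sub_one_le hlt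
      _ ≤ ‖(p : ℂ_[p])‖ * (‖(p : ℂ_[p])‖ ^ n * ‖w - 1‖) := by gcongr
      _ = ‖(p : ℂ_[p])‖ ^ (n + 1) * ‖w - 1‖ := by ring

/-- **`w^{pⁿ} → 1`** for a one-unit `w` of level `|p|`: the `p`-power powers of a one-unit ACCUMULATE at `1`.
[cite: Washington1997, §5.1] -/
theorem tendsto_pow_prime_pow_nhds_one {w : ℂ_[p]} (hw : ‖w - 1‖ < ‖(p : ℂ_[p])‖) :
    Tendsto (fun n : ℕ ↦ w ^ (p ^ n)) atTop (𝓝 1) := by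
  rw [tendsto_iff_norm_sub_tendsto_zero]
  refine squeeze_zero (fun n ↦ norm_nonneg _) (fun n ↦ norm_pow_prime_pow_sub_one_le hw n) ?_
  simpa using (tendsto_pow_atTop_nhds_zero_of_lt_one (norm_nonneg _) norm_prime_padicComplex_lt_one).mul_const ‖w - 1‖

/-! ### §3. Continuity of the value in the outer variable on a closed disc -/

/-- **CONTINUITY IN THE OUTER VARIABLE.** On a closed disc `‖x‖ ≤ ‖ϖ‖ < 1` with the inner value `y` (`‖y‖ ≤ ‖ϖ‖`) fixed: if
`xₙ → x₀` inside the disc, `L` has the values `wₙ` at `(xₙ, y)`, and `wₙ → w₀`, then `L` has the value `w₀` at `(x₀, y)` —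
the series of functions `x ↦ [T₁^iT₂^j]L·x^i y^j` converges uniformly on the disc (majorant `‖ϖ‖^{i+j}`), so its sum is continuous
there. [cite: Gouvea1993PadicNumbers, §5.6 Cor. 5.6.3] -/
theorem hasValueAt₂_of_tendsto {L : PowerSeries (UnrSeries p)} {ϖ : ℂ_[p]} (hϖ : ‖ϖ‖ < 1)
    {x : ℕ → ℂ_[p]} {x₀ y : ℂ_[p]} (hx : ∀ n, ‖x n‖ ≤ ‖ϖ‖) (hx₀ : ‖x₀‖ ≤ ‖ϖ‖) (hy : ‖y‖ ≤ ‖ϖ‖)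
    (hlim : Tendsto x atTop (𝓝 x₀)) {w : ℕ → ℂ_[p]} (hw : ∀ n, UnrSeries.HasValueAt₂ L (x n) y (w n))
    {w₀ : ℂ_[p]} (hw₀ : Tendsto w atTop (𝓝 w₀)) : UnrSeries.HasValueAt₂ L x₀ y w₀ := by
  -- the terms, their sum `F`, the disc `S` and the majorant
  set a : ℕ × ℕ → ℂ_[p] := fun k ↦ ((PowerSeries.coeff k.2 (PowerSeries.coeff k.1 L) : unrIntegers p) : ℂ_[p]) with ha
  set F : ℂ_[p] → ℂ_[p] := fun z ↦ ∑' k : ℕ × ℕ, a k * z ^ k.1 * y ^ k.2 with hF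
  set S : Set ℂ_[p] := {z | ‖z‖ ≤ ‖ϖ‖} with hS
  have hbound : ∀ (k : ℕ × ℕ), ∀ z ∈ S, ‖a k * z ^ k.1 * y ^ k.2‖ ≤ ‖ϖ‖ ^ k.1 * ‖ϖ‖ ^ k.2 := by
    intro k z hz
    rw [norm_mul, norm_mul, norm_pow, norm_pow]
    calc ‖a k‖ * ‖z‖ ^ k.1 * ‖y‖ ^ k.2 ≤ 1 * ‖ϖ‖ ^ k.1 * ‖ϖ‖ ^ k.2 := by
          gcongr
          · exact norm_coe_unrIntegers_le_one (p := p) _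
          · exact hz
      _ = ‖ϖ‖ ^ k.1 * ‖ϖ‖ ^ k.2 := by ring
  have hsum : Summable fun k : ℕ × ℕ ↦ ‖ϖ‖ ^ k.1 * ‖ϖ‖ ^ k.2 :=
    (summable_geometric_of_lt_one (norm_nonneg _) hϖ).mul_of_nonneg (summable_geometric_of_lt_one (norm_nonneg _) hϖ)
      (fun _ ↦ pow_nonneg (norm_nonneg _) _) (fun _ ↦ pow_nonneg (norm_nonneg _) _)
  have hcont : ContinuousOn F S :=
    continuousOn_tsum (fun k ↦ ((continuous_const.mul (continuous_pow k.1)).mul continuous_const).continuousOn) hsum hbound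
  have hval : ∀ z ∈ S, UnrSeries.HasValueAt₂ L z y (F z) := fun z hz ↦
    (Summable.of_norm_bounded hsum (fun k ↦ hbound k z hz)).hasSum
  -- `wₙ = F(xₙ) → F(x₀)`
  have hwF : ∀ n, w n = F (x n) := fun n ↦ (hw n).unique (hval _ (hx n))
  have hFlim : Tendsto (fun n ↦ F (x n)) atTop (𝓝 (F x₀)) := by
    have h1 : Tendsto x atTop (𝓝[S] x₀) := tendsto_nhdsWithin_iff.mpr ⟨hlim, Eventually.of_forall hx⟩
    exact (hcont x₀ hx₀).tendsto.comp h1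
  have hw₀' : w₀ = F x₀ := tendsto_nhds_unique hw₀ (hFlim.congr fun n ↦ (hwF n).symm)
  rw [hw₀']
  exact hval x₀ hx₀

/-! ### §4. The decay lemma -/

/-- **THE DECAY LEMMA.** Let `c, u` be one-units of level `|p|` and `‖y‖ ≤ ‖p‖`. If `L ∈ R₀⟦T₁⟧⟦T₂⟧` has the value `wᵢ` at the fibre
point `(c·u^{i+1} − 1, y)` for every `i`, and `‖wᵢ‖ ≤ C·θ^{i+1}` with `0 ≤ θ < 1`, then EVERY `wᵢ = 0`: the points of indices `i + pⁿ`
tend to the `i`-th point (`u^{pⁿ} → 1`, §2) while their values tend to `0`, and the value is continuous in the outer variable (§3).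
[cite: Gouvea1993PadicNumbers, §5.6 Cor. 5.6.3–5.6.4] [cite: Washington1997, §5.1] -/
theorem eq_zero_of_hasValueAt₂_of_norm_le_geometric {L : PowerSeries (UnrSeries p)} {u c y : ℂ_[p]}
    (hu : ‖u - 1‖ < ‖(p : ℂ_[p])‖) (hc : ‖c - 1‖ < ‖(p : ℂ_[p])‖) (hy : ‖y‖ ≤ ‖(p : ℂ_[p])‖)
    {w : ℕ → ℂ_[p]} (hw : ∀ i, UnrSeries.HasValueAt₂ L (c * u ^ (i + 1) - 1) y (w i))
    {C θ : ℝ} (hC : 0 ≤ C) (hθ0 : 0 ≤ θ) (hθ1 : θ < 1) (hdecay : ∀ i, ‖w i‖ ≤ C * θ ^ (i + 1)) (i : ℕ) :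
    w i = 0 := by
  have hp : p.Prime := Fact.out
  have hp1 : ‖(p : ℂ_[p])‖ < 1 := norm_prime_padicComplex_lt_one
  -- the fibre points lie in the closed disc of radius `‖p‖`
  have hc1 : ‖c‖ ≤ 1 := RamifiedSevenEllipticUnits.LemmaXi.norm_le_one_of_norm_sub_one_le_one (hc.le.trans hp1.le)
  have hpt : ∀ n : ℕ, ‖c * u ^ n - 1‖ ≤ ‖(p : ℂ_[p])‖ := fun n ↦
    (FibredSupply.norm_mul_sub_one_lt hc1 hc
      ((RamifiedSevenEllipticUnits.LemmaXi.norm_pow_sub_one_le (hu.le.trans hp1.le) n).trans_lt hu)).le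
  -- the accumulating subsequence `i + pⁿ`
  have hxlim : Tendsto (fun n : ℕ ↦ c * u ^ (i + p ^ n + 1) - 1) atTop (𝓝 (c * u ^ (i + 1) - 1)) := by
    have h1 : ∀ n : ℕ, c * u ^ (i + p ^ n + 1) - 1 = c * u ^ (i + 1) * u ^ (p ^ n) - 1 := fun n ↦ by ring
    simp_rw [h1]
    simpa using (((tendsto_pow_prime_pow_nhds_one hu).const_mul (c * u ^ (i + 1))).sub_const 1)
  have hwlim : Tendsto (fun n : ℕ ↦ w (i + p ^ n)) atTop (𝓝 0) := by
    refine squeeze_zero_norm (a := fun n ↦ C * θ ^ n) (fun n ↦ (hdecay (i + p ^ n)).trans ?_) ?_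
    · refine mul_le_mul_of_nonneg_left (pow_le_pow_of_le_one hθ0 hθ1.le ?_) hC
      have := Nat.lt_pow_self hp.one_lt (n := n)
      omega
    · simpa using (tendsto_pow_atTop_nhds_zero_of_lt_one hθ0 hθ1).const_mul C
  have h0 : UnrSeries.HasValueAt₂ L (c * u ^ (i + 1) - 1) y 0 :=
    hasValueAt₂_of_tendsto hp1 (fun n ↦ hpt _) (hpt _) hy hxlim (fun n ↦ hw (i + p ^ n)) hwlim
  exact (hw i).unique h0

end Summit.BirchSwinnertonDyer.BirchSwinnertonDyer.Theorems.UniversalToricDescentThinComb.ValueLimits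

end
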